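import Summits.QuantumFields.YangMills.Theorems.UnitScaleTiltProp7ConjResolventOfGreenBlockRows
import Summits.QuantumFields.YangMills.Theorems.UnitScaleTiltProp7OneFormGreenBlockSupFamily
import HarnessLib

/-!
# Route `UnitScaleTilt`, crux K1 «MinimiserStabilityRegPr» (stmt-QuantumFields-19200), EX rows `h137kπ` ∕ `h137kΔ` ∕ `hCk` — K-STOREY, FILE (K2b-δ₃)-S-η:
# **THE CLOSED η-SLOT `δ₃` FAMILY ON THE S-ROAD** — px10's `hres` family letter at `Δx := DeltaEtaSlot` for EVERY L-only slope `0 ≤ μ L < δG L`, from NOTHING but the weights,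
# the coupling window and `Lift`: ✓`conj_resolvent_DeltaEtaSlot_of_greenBlockSup` ∘ px16 ✓`blockSup_GT_DeltaEtaSlot_family` ((Gb)-FAMILY) ∘ ★p1 ✓`hco_DeltaEtaSlot_exists` ((γ)) ∘ ✓`posOnto_of_coercive`

Cell `ym3-torus` (HUMAN RULING D-0037; rung R3 = SU(2) YM₃ on T³ — NOT d = 4, NOT infinite volume, NOT a mass gap, NOT Clay).  Width seat `ym3-torus-px12` (gen 17), CLAIM 2026-08-30
13:16Z (first refusal px16 g14 ∕ px10 g14).  THEOREMS ONLY (0 `def`, 0 `sorry`, default heartbeats); `--supports stmt-QuantumFields-19200 --as helper`; count-neutral.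

WHAT IS PROVED (ns `Summit.QuantumFields.YangMills.Theorems.Prop7ConjResolventEtaFamilyOfGreenBlockSup`).
* ★★★ `conj_resolvent_DeltaEtaSlot_family_exists` — for positive L-only weights `c₀ cB` and a coupling window `0 < a₀ ≤ a₁` there are L-only `αδ BV δG : ℕ → ℝ` with `0 < αδ L`, the three
  cap windows `10¹²L³αδ L ≤ 1`, `10¹⁰L⁶αδ L ≤ 1`, `13·10¹⁴L³αδ L ≤ 1`, `0 ≤ BV L`, `0 < δG L`, such that FOR EVERY L-only slope `μ` with `0 ≤ μ L < δG L`: for every `L > 1`, member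
  `i : Idx L`, background `U₀` with `RegPr ρ U₀`, `ρ ≤ αδ L`, under `Lift`, coupling `a₀(c₀ L∕cB L)ℓ³ ≤ a ≤ a₁(c₀ L∕cB L)ℓ³`, px10's `hres` TEXT at `DeltaEtaSlot` and slope `μ L·η` with
  **`δ₃ L := 2·((BV L·(μ L·(2∕(δG L − μ L) + 6)·e^{6μ L}))·(2(1 + 2∕(δG L − μ L)))³)`** — the S-road twin of ✓`Prop7OneFormConjugateResolventFamily.conj_resolvent_oneForm_phaseClass_family`
  with ONE free knob `μ` (chosen afterwards by ✓∕⧗`Prop7KinvWindowRLInhabited.exists_slope_family_RL`) in place of `(r, α′)`.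
HYP-SAT (★★OWNER №42).  No displayed letter at all beyond the weights, the window and `Lift` (S47's thread); (γ) and (Gb) are LANDED ∃-packages consumed by `obtain`.
HONEST SCOPE.  Plumbing over landed doors; nothing of (γ)'s or (Gb)'s analytic inputs is re-proved; nothing of `hKinv`, `h133`, `norm_G`, the EX rows, `hThm2S`, EX or the crux is proved;
nothing continuum ∕ OS ∕ mass-gap ∕ Clay.

References: T. Bałaban, CMP **99** (1985) 389–434 [Balaban1985BackgroundPropagators] (Thm 3.1 (3.46) p.398, (3.49) p.399, (3.132) p.422, Thm 3.11 p.416); CMP **96** (1984) 223–250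
[Balaban1984PropagatorsII] (§2); CMP **102** (1985) 277–309 [Balaban1985Variational] (Thm 1 p.279).
-/

set_option autoImplicit false

noncomputable section

open scoped BigOperators Matrix.Norms.L2Operator InnerProductSpace ComplexConjugate

namespace Summit.QuantumFields.YangMills.Theorems.Prop7ConjResolventEtaFamilyOfGreenBlockSup

open Literature.MathematicalPhysics.QuantumFieldTheory.Balaban1983to89
open Literature.MathematicalPhysics.QuantumFieldTheory.Balaban1983to89.T3ContinuumYM3Torus
open Literature.MathematicalPhysics.QuantumFieldTheory.Balaban1983to89.T3PrintedRegularMinimiser (RegPr)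
open Literature.MathematicalPhysics.QuantumFieldTheory.Balaban1983to89.T3PrintedMinimiserExistence (regPr_mono)
open B15DeterminingSets (embIter)
open T3SectALandauChart (bgUnits eta)
open B11Eq103H1Complex (BondL2K)
open B5Eq118OneStroke (iterBlockOf)
open Summit.QuantumFields.YangMills.Theorems.Prop8Chart (emlIterU)
open Summit.QuantumFields.YangMills.Theorems.Prop7SectET3Transport (periodsT3)
open Summit.QuantumFields.YangMills.Theorems.Prop7SectET3HilbertLetters (W₂ toL2)
open Summit.QuantumFields.YangMills.Theorems.Prop7SectET3WilsonHessian (DeltaEtaSlot)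
open Summit.QuantumFields.YangMills.Theorems.Prop7SectET3CurvedPropagators (GT PosOnto)
open Summit.QuantumFields.YangMills.Theorems.Prop7OneFormCoerciveHolds (hco_DeltaEtaSlot_exists posOnto_of_coercive)
open Summit.QuantumFields.YangMills.Theorems.Prop7OneFormGreenBlockSupFamily (blockSup_GT_DeltaEtaSlot_family)
open Summit.QuantumFields.YangMills.Theorems.Prop7ConjResolventOfGreenBlockRows (conj_resolvent_DeltaEtaSlot_of_greenBlockSup)

/-- ★★★ **THE CLOSED η-SLOT `δ₃` FAMILY ON THE S-ROAD.**  For positive L-only weights `c₀ cB` and a coupling window `0 < a₀ ≤ a₁` there are `αδ BV δG : ℕ → ℝ` (cap, Green block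
constant, Green block rate; windows and signs) such that for EVERY L-only slope `0 ≤ μ L < δG L`, every `L > 1`, member `i : Idx L`, `RegPr ρ U₀` with `ρ ≤ αδ L`, under `Lift`, coupling
in `[a₀(c₀∕cB)ℓ³, a₁(c₀∕cB)ℓ³]`, every phase `φ` with `|φx − φx′| ≤ μ L·η·tdist x x′` and multipliers `M_f ↔ e^{φ(b₋)}`, `M_fi ↔ (e^{φ(b₋)})⁻¹`:
`‖M_f(G_T(M_fi x)) − G_T x‖ ≤ 2·((BV L·(μ L·(2∕(δG L − μ L) + 6)·e^{6μ L}))·(2(1 + 2∕(δG L − μ L)))³)·‖x‖`, `G_T = GT … a (DeltaEtaSlot …) U₀`.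
[cite: Balaban1985BackgroundPropagators, Thm 3.1 (3.46) p.398, (3.49) p.399, (3.132) p.422, Thm 3.11 p.416; Balaban1984PropagatorsII, §2] -/
theorem conj_resolvent_DeltaEtaSlot_family_exists (c₀ cB : ℕ → ℝ) [hc₀ : ∀ L : ℕ, Fact (0 < c₀ L)] [hcB : ∀ L : ℕ, Fact (0 < cB L)] {a₀ a₁ : ℝ} (ha₀ : 0 < a₀) (ha₀₁ : a₀ ≤ a₁) :
    ∃ (αδ BV δG : ℕ → ℝ),
      (∀ L : ℕ, 1 < L → 0 < αδ L) ∧ (∀ L : ℕ, 1 < L → 10 ^ 12 * (L : ℝ) ^ 3 * αδ L ≤ 1) ∧ (∀ L : ℕ, 1 < L → 10 ^ 10 * (L : ℝ) ^ 6 * αδ L ≤ 1) ∧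
      (∀ L : ℕ, 1 < L → 13 * 10 ^ 14 * (L : ℝ) ^ 3 * αδ L ≤ 1) ∧ (∀ L : ℕ, 1 < L → 0 ≤ BV L) ∧ (∀ L : ℕ, 1 < L → 0 < δG L) ∧
    ∀ μ : ℕ → ℝ, (∀ L : ℕ, 1 < L → 0 ≤ μ L) → (∀ L : ℕ, 1 < L → μ L < δG L) →
    ∀ (L : ℕ), 1 < L → ∀ (i : T3Thm1Carrier.Idx L) (U₀ : GaugeField (i.1.1.P i.1.2.2) 0 (Matrix.specialUnitaryGroup (Fin 2) ℂ)), ∀ ρ : ℝ,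
      RegPr i.1.1 i.1.2.1 i.1.2.2 ρ U₀ → ρ ≤ αδ L →
        (∀ cf : Site (i.1.1.P i.1.2.2) (i.1.2.2 - i.1.2.1) → Matrix (Fin 2) (Fin 2) ℂ,
        (∀ e' : PBond (i.1.1.P i.1.2.2) (i.1.2.2 - i.1.2.1), cf e'.src = ((emlIterU (i.1.2.2 - i.1.2.1) (bgUnits i.1.1 i.1.2.2 U₀) e' : (Matrix (Fin 2) (Fin 2) ℂ)ˣ) : Matrix (Fin 2) (Fin 2) ℂ) * cf e'.tgt *
        (((emlIterU (i.1.2.2 - i.1.2.1) (bgUnits i.1.1 i.1.2.2 U₀) e')⁻¹ : (Matrix (Fin 2) (Fin 2) ℂ)ˣ) : Matrix (Fin 2) (Fin 2) ℂ)) →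
        ∃ l₀ : Site (i.1.1.P i.1.2.2) 0 → Matrix (Fin 2) (Fin 2) ℂ,
        (∀ b' : PBond (i.1.1.P i.1.2.2) 0, l₀ b'.src = ((bgUnits i.1.1 i.1.2.2 U₀ b' : (Matrix (Fin 2) (Fin 2) ℂ)ˣ) : Matrix (Fin 2) (Fin 2) ℂ) * l₀ b'.tgt * (((bgUnits i.1.1 i.1.2.2 U₀ b')⁻¹ : (Matrix (Fin 2) (Fin 2) ℂ)ˣ) : Matrix (Fin 2) (Fin 2) ℂ)) ∧
        ∀ y : Site (i.1.1.P i.1.2.2) (i.1.2.2 - i.1.2.1), l₀ (embIter (i.1.2.2 - i.1.2.1) y) = cf y) →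
      ∀ a : ℝ, a₀ * (c₀ L / cB L) * ((i.1.1.L : ℝ) ^ (i.1.2.2 - i.1.2.1)) ^ 3 ≤ a → a ≤ a₁ * (c₀ L / cB L) * ((i.1.1.L : ℝ) ^ (i.1.2.2 - i.1.2.1)) ^ 3 →
      ∀ φ : Site (i.1.1.P i.1.2.2) 0 → ℝ, (∀ x x' : Site (i.1.1.P i.1.2.2) 0, |φ x - φ x'| ≤ μ L * eta i.1.1 i.1.2.1 i.1.2.2 * (Site.tdist x x' : ℝ)) →
      ∀ (Mf Mfi : BondL2K ℂ 3 (periodsT3 i.1.1 i.1.2.2) (c₀ L) W₂ →ₗ[ℂ] BondL2K ℂ 3 (periodsT3 i.1.1 i.1.2.2) (c₀ L) W₂),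
        (∀ X, Mf (toL2 i.1.1 i.1.2.2 (c₀ L) X) = toL2 i.1.1 i.1.2.2 (c₀ L) (fun b => Real.exp (φ b.src) • X b)) →
        (∀ X, Mfi (toL2 i.1.1 i.1.2.2 (c₀ L) X) = toL2 i.1.1 i.1.2.2 (c₀ L) (fun b => (Real.exp (φ b.src))⁻¹ • X b)) →
        ∀ x, ‖Mf (GT i.1.1 i.1.2.1 i.1.2.2 i.2.2.le (c₀ L) (cB L) a (DeltaEtaSlot i.1.1 i.1.2.1 i.1.2.2 (c₀ L)) U₀ (Mfi x))
              - GT i.1.1 i.1.2.1 i.1.2.2 i.2.2.le (c₀ L) (cB L) a (DeltaEtaSlot i.1.1 i.1.2.1 i.1.2.2 (c₀ L)) U₀ x‖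
          ≤ (2 * ((BV L * (μ L * (2 / (δG L - μ L) + 6) * Real.exp (6 * μ L))) * (2 * (1 + 2 / (δG L - μ L))) ^ 3)) * ‖x‖ := by
  obtain ⟨αco, γco, hαco, hWco, hwinco, hγco, hco⟩ := hco_DeltaEtaSlot_exists c₀ cB ha₀
  obtain ⟨αG, BV, δG, hαG, hWG12, hWG10, hWG13, hBV, hδG, hGb⟩ := blockSup_GT_DeltaEtaSlot_family c₀ cB ha₀ ha₀₁
  -- the cap
  set αδ : ℕ → ℝ := fun L => min (αco L) (αG L) with hαδ
  have hαδco : ∀ L, αδ L ≤ αco L := fun L => min_le_left _ _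
  have hαδG : ∀ L, αδ L ≤ αG L := fun L => min_le_right _ _
  refine ⟨αδ, BV, δG, fun L hL => lt_min (hαco L hL) (hαG L hL), fun L hL => ?_, fun L hL => ?_, fun L hL => ?_, hBV, hδG, ?_⟩
  · have hL0 : (0 : ℝ) < L := by exact_mod_cast lt_trans zero_lt_one hL
    exact (mul_le_mul_of_nonneg_left (hαδG L) (by positivity)).trans (hWG12 L hL)
  · have hL0 : (0 : ℝ) < L := by exact_mod_cast lt_trans zero_lt_one hL
    exact (mul_le_mul_of_nonneg_left (hαδG L) (by positivity)).trans (hWG10 L hL)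
  · have hL0 : (0 : ℝ) < L := by exact_mod_cast lt_trans zero_lt_one hL
    exact (mul_le_mul_of_nonneg_left (hαδG L) (by positivity)).trans (hWG13 L hL)
  -- the member
  intro μ hμ0 hμδ L hL i U₀ ρ hreg hρ hlift a ha₀a ha₁a
  have hL0 : (0 : ℝ) < L := by exact_mod_cast lt_trans zero_lt_one hL
  have hLL : (L : ℝ) = (i.1.1.L : ℝ) := by rw [i.2.1]
  -- the window `13·10¹⁴L³ρ ≤ 1` at this member
  have hwin : 13 * 10 ^ 14 * (i.1.1.L : ℝ) ^ 3 * ρ ≤ 1 := by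
    rw [← hLL]
    exact (mul_le_mul_of_nonneg_left (hρ.trans (hαδG L)) (by positivity)).trans (hWG13 L hL)
  -- (γ) and `PosOnto` at this member
  have hco' := hco L hL i U₀ ρ hreg (hρ.trans (hαδco L)) hlift a ha₀a
  have hp : PosOnto i.1.1 i.1.2.1 i.1.2.2 i.2.2.le (c₀ L) (cB L) a (DeltaEtaSlot i.1.1 i.1.2.1 i.1.2.2 (c₀ L)) U₀ :=
    posOnto_of_coercive i.2.2.le (cB L) i.2.2 hreg hwin (hγco L hL) (DeltaEtaSlot i.1.1 i.1.2.1 i.1.2.2 (c₀ L)) hco'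
  -- (Gb) at this member, then the S-road member theorem
  have hGblk := hGb L hL i U₀ ρ hreg (hρ.trans (hαδG L)) hlift a ha₀a ha₁a
  exact conj_resolvent_DeltaEtaSlot_of_greenBlockSup i.1.1 i.2.2.le (c₀ L) (cB L) U₀ a hp (hBV L hL) (hμ0 L hL) (hμδ L hL) hGblk

end Summit.QuantumFields.YangMills.Theorems.Prop7ConjResolventEtaFamilyOfGreenBlockSup

end
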